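import Literature.Claims.NS.ClayPeriodicLerayHopfBridge
import HarnessLib

/-!
# Claim skeleton (D-0090 NS-CLAIMS, C173): Tibola, «Global Regularity for 3D Navier–Stokes via
# Finite-Scale Contraction and Audited Pressure Ledgers» (Zenodo 17625718, 2025, 59 pp.)

Typed CHAIN-LEVEL skeleton (QUICK row) of B. Tibola, *Global Regularity for 3D Navier–Stokes via
Finite-Scale Contraction and Audited Pressure Ledgers*, Zenodo record **17625718** (concept 17625717,
SINGLE version 2025-11-17; PDF sha16 `1b36a833af6a98c4`, 59 pp.; PDF page = printed page = file
`census/texts/Tibola2025/pages/pNNN.txt`, line numbers below are the lines of those files;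
`sources/Tibola2025/LOCATORS.md` v2 462d2971758aeb6c). Numbered C173 by RULINGS v1.48
(ns-claims-lead-1 g7, 2026-08-27T16:29:21Z). Appendix theorem numbers print as «Theorem .1» /
«Corollary .2»; «Lemma 13.8», «Prop 13.9», «Cor 13.18», «Corollary B.2» are cited in the text but are
not printed anywhere in the 59 pp. (LOCATORS v2 (d)).

## Setting and claimed statement
Forced incompressible Navier–Stokes on the flat torus `𝕋³`, viscosity `ν > 0` (Thm 10.1 p.19; Thm 12.1
p.24 l.75–78). CLAIMED (REG, POS): **Appendix B «Theorem .1» p.39 l.10–33** (= abstract p.1 l.5–14;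
restated Thm 13.1 p.34 l.46–66): «Let u0 ∈ L²(T³) be divergence-free and let f ∈ L¹_loc H⁻¹(T³) with
local L^{3/2} control on time windows. Consider the UR-structured approximations of Sections P1–P5 and
their Leray–Hopf limit u. Then u is a global classical solution of the 3D Navier–Stokes equations on
T³; any Leray–Hopf solution on T³ coincides with u (energy equality holds for all t > 0).» THREE faces:
(a) REGULARITY — typed `ClaimedRegularity` as the ∃-face «some global Leray–Hopf solution from (u₀, f)
is classical on (0,∞) × 𝕋³» (RULINGS (h4); Thm 13.1 l.66 «u is smooth for all t > 0»; for L² data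
«classical» can only mean t > 0); (b) Leray–Hopf UNIQUENESS `ClaimedUniqueness` (typed: consumed by
the printed «Smoothness implies … uniqueness» passage and by the Clay (B) door); (c) energy equality —
recorded only. `ClaimedTheorem ν := ClaimedRegularity ν ∧ ClaimedUniqueness ν`. Cor «.2» p.39 l.45–84
(ℝ³ by expanding tori) recorded only.

## Vocabulary
* `IsDatum u₀` := `u₀ ∈ L²(𝕋³)` ∧ weakly divergence-free (p.39 l.12–16) — ALL such data, as printed.
* `IsForce f` := the print's «f ∈ L¹_loc H⁻¹(T³) with local L^{3/2} control on time windows» rendered by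
  the space–time `L^{3/2}` window control that the forcing functional `F_h` integrates (p.20 l.90–99):
  `f` a.e.-strongly measurable and `∬_{(0,T)×𝕋³} |f|^{3/2} < ∞` for every `T` (zero force is in it:
  `isForce_zero`). The H⁻¹ wording is recorded; `L^{3/2}(𝕋³) ⊂ H⁻¹(𝕋³)`.
* Solutions: the tree's torus Leray–Hopf class `Torus.IsGlobalLerayHopf ν f u₀ u` (Thm 12.1 p.24 l.86
  «every Leray–Hopf solution»; Thm B.1 «their Leray–Hopf limit u»); classical = the tree's
  `Torus.IsClassicalNSSolutionOn`.
* `cyl r z` = the parabolic cylinder `Q_r(x₀,t₀) = (t₀ − r², t₀) × B_r(x₀)` on `𝕋³` (p.27 l.30–32);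
  `Phi u p r z` = the scale-invariant CKN quantity `r⁻² ∬_{Q_r(z)} (|u|³ + |p|^{3/2})` (§10.2 p.20
  l.80–89 `A_h`, Thm 10.5 l.131–140) — the «(normalized as in §§9–11)» reading of Lemma 12.20's `Φ`
  (the ONLY normalisation display in §§9–11; REF-2 g8 RETYPE v0 (a)); the LITERAL ball form of (12.12)
  (`‖u‖³_{L³(B_ρ)} + ‖p‖^{3/2}_{L^{3/2}(B_ρ)}` at a time, no power of ρ) is the recorded face
  `Step_L1220_ball`; `Admissible r z` := `0 < r ≤ 1/2 ∧ r² < t₀` («h ≪ r ≪ 1» for the limit; the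
  cylinder lies in `(0,∞) × 𝕋³`).
* `Ledger` = the print's named analytic constants as PARAMETERS (RULINGS (h2); REF (c)): `κw` (far-field
  UC_w coefficient, Lemma 12.17 p.32 l.1–4), `Ciso, ctail, C0, C1, Cstar, CNF, M1, M2`, with the printed
  RELATIONS as definitions — `cloc` (12.11) p.32 l.45–56, `theta Λ = κw Λ + cloc/Λ` (12.11), `kappaStar`
  (Table I′.1 p.47 l.14–25 / (K.0) p.56). Printed VALUES (Appendix I′ Table 4 p.47 l.33–54, «Worked
  evaluation» p.48 l.1–17: `M1 = 1, M2 = 2.16, Ciso = 8, ctail = 5.83e−15, C∗ = 6, C0 = C1 = 6.545455,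
  cloc = 4.158, κw(6) = 4.36e−12, θ(6) = 0.6930000000044`; CNF, CBMO «fixed analytic bound», no value)
  are recorded as `table4_*` constants with `table4_theta6_lt_one` PROVED (the certificate's arithmetic on
  its own digits); the conflicting printings «C0 = 24, C1 = 48» (App. C p.41 l.37, l.60), «Ciso := C_M ≤
  512 … Record Ciso = 512» (App. D p.42 l.83, l.87), «C0 ≤ 1, C1 ≤ 1» (p.30 l.26) are recorded here.
* `URKit` = the paper's discrete scheme objects as named DATA (posits, not steps; RULINGS 11:21Z (1),
  `Cox2025.CarlemanKit` / `Sarici2026.LPKit` pattern): the CKN functionals `A_h, E_h, F_h` of the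
  UR-structured approximations ((12.10) p.32, §10.2 p.20) and the pressure `π` the scheme attaches to its
  Leray–Hopf limit (Thm 10.5 «|π|^{3/2}»; the print defines `π` only as the limit of `π_h`) — with ONE
  pinning clause `press_classical`: on a classical pair with mean-zero pressure the kit returns that
  pressure (this fixes the MEANING of the posit `π`; it asserts nothing of the paper).

## The printed chain (p.1 l.41 «proof stream»; p.39 l.34–44; proof of Thm 12.1 p.26 l.1–33) = binder
## order of `claim_of_steps`
1. `Step_T1219 K L` — Thm 12.19 (12.10) p.32 l.18–38, the scale step WITH its additive dissipation /
   forcing term, conditional on «θ(Λ) ∈ (0,1)» as printed; discrete, kit-relative; TRUE-type (REF (i)).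
2. `Step_C1221 L` — Cor 12.21 p.32 l.67–73 «θ(6) = κw(6) + cloc/6 < 1», the bare real inequality over
   the ledger (Cor 12.16 p.31 l.47–53 prints it CONDITIONALLY; Cor 12.4 (12.1)–(12.2) p.26 l.72 – p.27
   l.3 bounds it by named constants; Table 4 / p.48 instantiate it: `table4_theta6_lt_one`).
3. `Step_L1220_of K L ν := Step_T1219 K L → Step_C1221 L → Step_L1220 K L ν` — **the seam**: Lemma
   12.20 (12.12) p.32 l.57–66 «Let Λ = 6 and suppose θ(6) < 1. For Φ(ρ) := … (normalized as in §§9–11),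
   Φ(r) ≤ θ(6) Φ(6r)» — a PURE contraction of the CKN functional of every Leray–Hopf solution at every
   admissible cylinder, the additive term of (12.10) gone; `Step_L1220` is its content, the iterate
   (12.13) is PROVED from it (`phi_iterate_of_step_L1220`).
4. `Step_anchor K ν` — p.26 l.1–6 «select an anchor radius R∗ … so that Φ(R∗; z0) ≤ M∗ < ∞; this
   follows from the global L²_t H¹_x bound and the pressure ledgers» (TRUE-type for an honest pressure).
5. `Step_T105 K ν` — Thm 10.5 p.20 l.131–141 (ε-regularity in the limit, with Thm 10.4's bound
   «sup_{Q_cr} |U| ≤ C/(r ε₀^{1/3})» l.100–112), TRUE-type CKN class.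
6. `Step_Vitali ν` — p.26 l.29–31 / p.39 l.40–43 «A Vitali covering … yields smoothness on (0,∞) × T³»:
   locally bounded around every interior point ⇒ classical on (0,∞) × 𝕋³ (as printed; for the printed
   ROUGH force class this is the print's own assertion).
7. `Step_Hopf ν` — Thm B.1 p.39 l.26–27 «Consider the UR-structured approximations … and their
   Leray–Hopf limit u»: existence of a global Leray–Hopf solution for every datum/force of the class
   (TRUE-type: Hopf).
8. `Step_Uniq ν` — p.26 l.31–32 / p.39 l.43–44 «Smoothness implies energy equality and uniqueness in
   the Leray–Hopf class» (as printed, for L² data and the printed force class).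

COMPOSITION — PROVED, every binder consumed: `claim_of_steps K L hν : Step_T1219 K L → Step_C1221 L →
Step_L1220_of K L ν → Step_anchor K ν → Step_T105 K ν → Step_Vitali ν → Step_Hopf ν → Step_Uniq ν →
ClaimedTheorem ν` (the «choose k0 so that the right-hand side is ≤ ε0» passage p.26 l.22–25 is kernel
logic here: `exists_pow_mul_le`). CLAY LINK (PROVED): nearest (B) `clayPeriodic.Regularity`; the claim
is WIDER (all L² data, forcing); `clayB_of_claimed (hν) : ClaimedTheorem ν → clayPeriodic.RegularityAt ν`
(smooth periodic unforced data ⊂ the class — `isDatum_descend`, `isForce_zero` —, door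
`clayPeriodic_regularityAt_iff_lerayHopf_boundedFromLeft`: every global Leray–Hopf solution from the
descended datum coincides a.e. with the classical one, bounded on compact sub-slabs —
`exists_bound_of_classical`), `clay_of_claimed`, `clay_of_steps`; no «wrong problem» axis;
`claimedTheorem_iff_clayB` is NOT expected (the claim is far stronger than (B)). Not typed (recorded): Thm 10.1 p.19 l.71–92 (discrete LEI,
no θ/Φ in it — LOCATORS v2 (a)); Thm 10.4 (discrete twin of 10.5); Thm 12.1 p.24 l.75–89 (its
∀-Leray–Hopf conclusion is what Steps 3–8 compose; its printed proof p.26 KEEPS the error sum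
«Σ θ^j Err» l.7–21 that Lemma 12.20 drops — REF (d)); Cor 12.2/13.2/«.2» (ℝ³); §12.2 bounded domains;
App. A–Y′; the numerical «acceptance tests» p.34 l.28–44 (AS ASSERTED, never re-run); energy equality.

## References
* B. Tibola, *Global Regularity for 3D Navier–Stokes via Finite-Scale Contraction and Audited Pressure
  Ledgers*, Zenodo record 17625718 (2025), 59 pp. [Tibola2025]
* C. L. Fefferman, *Existence and smoothness of the Navier–Stokes equation*, CMI 2006, (B) with (8),
  (10), (11) p. 2. [FeffermanClay2006]
* L. Caffarelli, R. Kohn, L. Nirenberg, Comm. Pure Appl. Math. 35 (1982), Prop. 1–2. [CKN1982]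

WHAT THIS IS NOT: not a claim about NS regularity or blow-up; not a claim about any author beyond the
typed locator.
-/

open scoped ContDiff ENNReal NNReal Topology RealInnerProductSpace
open Set Filter MeasureTheory Function

namespace Literature.Claims.NS.Tibola2025

open Literature.Analysis Literature.Analysis.FluidPDE Literature.Analysis.FunctionSpaces
  Literature.Claims.NS.ClayVariants

noncomputable section

/-! ## Vocabulary -/

/-- The flat three-torus `𝕋³`. [cite: Tibola2025, Thm .1 p.39 l.10–16] -/
abbrev T3 : Type := UnitAddTorus (Fin 3)

/-- `ℝ³` (velocity values). [cite: Tibola2025, Thm 12.1 p.24 l.75–78] -/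
abbrev E3 : Type := EuclideanSpace ℝ (Fin 3)

/-- **Data class as printed**: `u₀ ∈ L²(𝕋³)`, (weakly) divergence-free — ALL such data.
[cite: Tibola2025, Thm .1 p.39 l.12–16; Thm 13.1 p.34 l.48–53] -/
def IsDatum (u₀ : T3 → E3) : Prop :=
  MemLp u₀ 2 volume ∧ Torus.IsWeaklyDivFree u₀

/-- **Force class as printed** («f ∈ L¹_loc H⁻¹(T³) with local L^{3/2} control on time windows»),
rendered by the space–time `L^{3/2}` window control the forcing functional `F_h` (p.20 l.90–99)
integrates: a.e.-strongly measurable with `∬_{(0,T)×𝕋³} |f|^{3/2} < ∞` for every `T > 0`.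
[cite: Tibola2025, Thm .1 p.39 l.17–26; §10.2 p.20 l.90–99] -/
def IsForce (f : ℝ → T3 → E3) : Prop :=
  AEStronglyMeasurable (uncurry f) volume ∧
    ∀ T : ℝ, 0 < T → (∫⁻ q in Ioo 0 T ×ˢ (univ : Set T3), ‖f q.1 q.2‖ₑ ^ (3 / 2 : ℝ)) < ⊤

/-- The zero force is in the printed class. [cite: Tibola2025, Thm .1 p.39 l.17–26] -/
theorem isForce_zero : IsForce 0 := by
  refine ⟨?_, fun T _ => ?_⟩
  · exact (aestronglyMeasurable_const (b := (0 : E3))).congr (ae_of_all _ fun q => rfl)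
  · have h32 : (0 : ℝ) < 3 / 2 := by norm_num
    simp [ENNReal.zero_rpow_of_pos h32]

/-- The parabolic cylinder `Q_r(x₀, t₀) = (t₀ − r², t₀) × B_r(x₀)` on `𝕋³` (p.27 l.30–32; Thm 12.19
p.32 l.24 `Q_r = Q_r(x0, t0)`), in the tree's `(t, x)` order. [cite: Tibola2025, §12.2 p.27 l.30–32] -/
def cyl (r : ℝ) (z : ℝ × T3) : Set (ℝ × T3) := Ioo (z.1 - r ^ 2) z.1 ×ˢ Metric.ball z.2 r

/-- **The scale-invariant CKN functional** `Φ(r; z₀) = r⁻² ∬_{Q_r(z₀)} (|u|³ + |p|^{3/2}) dx dt`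
(§10.2 p.20 l.80–89 `A_h`; Thm 10.5 p.20 l.131–140; the «(normalized as in §§9–11)» reading of Lemma
12.20's Φ, REF-2 RETYPE v0 (a)). `ℝ≥0∞`-valued. [cite: Tibola2025, §10.2 p.20 l.80–89; Lemma 12.20 p.32 l.57–63] -/
def Phi (u : ℝ → T3 → E3) (p : ℝ → T3 → ℝ) (r : ℝ) (z : ℝ × T3) : ℝ≥0∞ :=
  (ENNReal.ofReal (r ^ 2))⁻¹ *
    ∫⁻ q in cyl r z, (‖u q.1 q.2‖ₑ ^ (3 : ℕ) + ‖p q.1 q.2‖ₑ ^ (3 / 2 : ℝ))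

/-- **The LITERAL functional of (12.12)**: `Φ(ρ) := ‖u‖³_{L³(B_ρ)} + ‖p‖^{3/2}_{L^{3/2}(B_ρ)}` on the
space ball `B_ρ(x₀)` at a time `t`, no power of `ρ` (Lemma 12.20 p.32 l.58–63 as displayed).
[cite: Tibola2025, Lemma 12.20 p.32 l.57–63] -/
def PhiBall (u : ℝ → T3 → E3) (p : ℝ → T3 → ℝ) (ρ : ℝ) (x₀ : T3) (t : ℝ) : ℝ≥0∞ :=
  (∫⁻ x in Metric.ball x₀ ρ, ‖u t x‖ₑ ^ (3 : ℕ)) + ∫⁻ x in Metric.ball x₀ ρ, ‖p t x‖ₑ ^ (3 / 2 : ℝ)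

/-- Admissible cylinders for the limit («h ≪ r ≪ 1», Thm 12.19 p.32 l.24–25; the cylinder inside
`(0,∞) × 𝕋³`): `0 < r ≤ 1/2` and `r² < t₀`. [cite: Tibola2025, Thm 12.19 p.32 l.24–25] -/
def Admissible (r : ℝ) (z : ℝ × T3) : Prop := 0 < r ∧ r ≤ 1 / 2 ∧ r ^ 2 < z.1

/-- Admissibility is inherited by smaller positive radii. [cite: Tibola2025, Lemma 12.20 p.32 l.65–66] -/
theorem Admissible.mono {r r' : ℝ} {z : ℝ × T3} (h : Admissible r z) (h0 : 0 < r') (hle : r' ≤ r) :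
    Admissible r' z := by
  refine ⟨h0, hle.trans h.2.1, lt_of_le_of_lt ?_ h.2.2⟩
  exact pow_le_pow_left₀ h0.le hle 2

/-- «u is locally bounded around every interior space–time point» — the output of ε-regularity at every
point, the input of the Vitali passage (p.26 l.25–31). [cite: Tibola2025, proof of Thm 12.1 p.26 l.25–31] -/
def LocallyBounded (u : ℝ → T3 → E3) : Prop :=
  ∀ z : ℝ × T3, 0 < z.1 → ∃ r : ℝ, 0 < r ∧ ∃ C : ℝ,
    ∀ᵐ q ∂(volume.restrict (cyl r z)), ‖u q.1 q.2‖ ≤ C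

/-! ## The ledger of named constants (parameters; printed relations as definitions) -/

/-- **The analytic ledger** (Firewall p.32 l.39–44 «All symbols in θ(Λ) come from the analytic ledger:
C0, C1 (discrete CZ size/gradient), Ciso (isotropy-defect rate Ciso/Λ), C∗ (commutator/JN), the
shoulder budgets M1, M2, and the far-tail constant ctail»; `CNF` = the near-field prefactor of (12.11);
`κw` = the far-field UC_w contraction coefficient of Lemma 12.17 p.32 l.1–4, a function of Λ). Bound as
PARAMETERS (RULINGS v1.48 (h2); REF-2 RETYPE v0 (c)); printed values recorded below as `table4_*`.
[cite: Tibola2025, p.32 l.39–56; Lemma 12.17 p.32 l.1–4] -/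
structure Ledger where
  /-- far-field UC_w contraction coefficient `κ_w(Λ)` (Lemma 12.17). -/
  κw : ℝ → ℝ
  /-- isotropy-defect constant `C_iso` (ε_iso(Λ) = C_iso/Λ). -/
  Ciso : ℝ
  /-- far-tail constant `c_tail` (order 3). -/
  ctail : ℝ
  /-- discrete CZ size constant `C0`. -/
  C0 : ℝ
  /-- discrete CZ gradient constant `C1`. -/
  C1 : ℝ
  /-- commutator / John–Nirenberg constant `C∗`. -/
  Cstar : ℝ
  /-- near-field prefactor `C_NF` (`C_NFh`). -/
  CNF : ℝ
  /-- shoulder budget `M1`. -/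
  M1 : ℝ
  /-- shoulder budget `M2`. -/
  M2 : ℝ

/-- **(12.11) p.32 l.45–56**: `c_loc = C_NFh [(C0 + C1) + C∗ M1^{2/3} M2^{1/3}]`.
[cite: Tibola2025, (12.11) p.32 l.45–56] -/
def Ledger.cloc (L : Ledger) : ℝ :=
  L.CNF * ((L.C0 + L.C1) + L.Cstar * L.M1 ^ (2 / 3 : ℝ) * L.M2 ^ (1 / 3 : ℝ))

/-- **(12.11) / Thm 12.19 p.32 l.18–22**: `θ(Λ) = κ_w(Λ) + c_loc/Λ`.
[cite: Tibola2025, (12.11) p.32 l.45–47; Thm 12.19 p.32 l.18–22] -/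
def Ledger.theta (L : Ledger) (Λ : ℝ) : ℝ := L.κw Λ + L.cloc / Λ

/-- The far-field envelope `κ⋆(Λ) = (8/7) c_tail C0³ (1 + C_iso/Λ)` (Table I′.1 p.47 l.14–25; (K.0)
p.56 l.128–140; p.47 l.58–68), the printed bound `κ_w(Λ) ≤ κ⋆(Λ)`. [cite: Tibola2025, Table I′.1 p.47 l.14–25] -/
def Ledger.kappaStar (L : Ledger) (Λ : ℝ) : ℝ := 8 / 7 * L.ctail * L.C0 ^ 3 * (1 + L.Ciso / Λ)

/-- Appendix I′ Table 4 p.47 l.42: «Ciso … 8» (App. D p.42 l.83/l.87 prints «Ciso := C_M ≤ 512 … Record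
Ciso = 512» — conflicting printing, recorded). [cite: Tibola2025, Table 4 p.47 l.42] -/
def table4_Ciso : ℝ := 8
/-- Table 4 p.47 l.43: «ctail … 5.83 × 10⁻¹⁵». [cite: Tibola2025, Table 4 p.47 l.43] -/
def table4_ctail : ℝ := 5.83e-15
/-- Table 4 p.47 l.52–53: «C0 … 6.545455», «C1 … 6.545455» (App. C p.41 l.37/l.60 prints «C0 = 24,
C1 = 48»; p.30 l.26 prints «C0 ≤ 1, C1 ≤ 1» — conflicting printings, recorded). [cite: Tibola2025, Table 4 p.47 l.52–53] -/
def table4_C0 : ℝ := 6.545455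
/-- Table 4 p.47 l.54: «cloc … 4.158» (computed «from the primitives»; `CNF`, `CBMO` carry no printed
value). [cite: Tibola2025, Table 4 p.47 l.54] -/
def table4_cloc : ℝ := 4.158
/-- «Worked evaluation» p.48 l.1–13: «κw(6) = (8/7) ctail C0³ (1 + 8/6) = 4.36 × 10⁻¹²».
[cite: Tibola2025, App. I′ p.48 l.1–13] -/
def table4_kappaw6 : ℝ := 4.36e-12
/-- «Worked evaluation» p.48 l.12–13: «θ(6) = κw(6) + cloc/6 = 0.6930000000044».
[cite: Tibola2025, App. I′ p.48 l.12–13] -/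
def table4_theta6 : ℝ := table4_kappaw6 + table4_cloc / 6

/-- **The certificate's arithmetic on its own digits is TRUE**: `κw(6) + cloc/6 < 1` for the Table-4 /
p.48 values (so Cor 12.21 instantiated by Appendix I′ holds; records). [cite: Tibola2025, App. I′ p.48 l.1–17; Cor 12.21 p.32 l.67–73] -/
theorem table4_theta6_lt_one : table4_theta6 < 1 := by
  norm_num [table4_theta6, table4_kappaw6, table4_cloc]

/-! ## The scheme's discrete objects and its pressure, as named DATA -/

/-- **The UR-structured scheme's gadgets as named DATA** (posits, not steps): the CKN functionals of the
discrete approximations — `A h u₀ f r z = A_h(Q_r(z))` «:= r⁻² ∬_{Q_r} (|U^{pc}|³ + |π_h|^{3/2})»,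
`E h … = E_h(Q_r) := r⁻² ∬_{Q_r} |∇_h U^{pc}|²`, `F h … = F_h(Q_r)` (forcing/flux) — for mesh `h`,
datum, force, radius, centre (§10.2 p.20 l.80–99; (12.10) p.32 l.26–38), and the pressure `π` the
scheme attaches to a Leray–Hopf solution `u` from `(u₀, f)` (Thm 10.5 p.20 l.131–140 «|π|^{3/2}»; the
print defines `π` only through `π_h`). The single clause `press_classical` pins the meaning of `π`: on a
classical pair whose pressure has zero mean at each time, `π` IS that pressure.
[cite: Tibola2025, §10.2 p.20 l.80–99; Thm 12.19 p.32 l.18–38; Thm 10.5 p.20 l.131–140] -/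
structure URKit where
  /-- `A_h(Q_r(z))` for the approximation from `(u₀, f)` at mesh `h`. -/
  A : ℝ → (T3 → E3) → (ℝ → T3 → E3) → ℝ → ℝ × T3 → ℝ≥0∞
  /-- `E_h(Q_r(z))`, the scale-invariant discrete dissipation. -/
  E : ℝ → (T3 → E3) → (ℝ → T3 → E3) → ℝ → ℝ × T3 → ℝ≥0∞
  /-- `F_h(Q_r(z))`, the forcing/flux functional. -/
  F : ℝ → (T3 → E3) → (ℝ → T3 → E3) → ℝ → ℝ × T3 → ℝ≥0∞
  /-- the pressure `π` attached to a Leray–Hopf solution `u` from `(u₀, f)`. -/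
  press : (T3 → E3) → (ℝ → T3 → E3) → (ℝ → T3 → E3) → (ℝ → T3 → ℝ)
  /-- pinning clause: on a classical pair `(u, p)` on a time set `S` with `∫ p(t) = 0`, `π = p` on `S`. -/
  press_classical : ∀ (ν : ℝ) (S : Set ℝ) (u₀ : T3 → E3) (f u : ℝ → T3 → E3) (p : ℝ → T3 → ℝ),
    Torus.IsClassicalNSSolutionOn S ν f u p → (∀ t ∈ S, ∫ x, p t x = 0) →
      ∀ t ∈ S, press u₀ f u t = p t

/-! ## The claimed statement -/

/-- **Face (a) — REGULARITY (Thm .1 p.39 l.26–29; Thm 13.1 p.34 l.62–66 «admit a global classical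
solution u … u is smooth for all t > 0»)**, the ∃-face (RULINGS (h4)): for every datum and force of the
printed classes, SOME global Leray–Hopf solution from `(u₀, f)` is a classical solution on
`(0,∞) × 𝕋³`. [claim: Tibola2025, status: under-review] [cite: Tibola2025, Thm .1 p.39 l.10–33; Thm 13.1 p.34 l.46–66] -/
def ClaimedRegularity (ν : ℝ) : Prop :=
  ∀ (u₀ : T3 → E3) (f : ℝ → T3 → E3), IsDatum u₀ → IsForce f →
    ∃ u : ℝ → T3 → E3, Torus.IsGlobalLerayHopf ν f u₀ u ∧
      ∃ p : ℝ → T3 → ℝ, Torus.IsClassicalNSSolutionOn (Ioi 0) ν f u p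

/-- **Face (b) — Leray–Hopf UNIQUENESS (Thm .1 p.39 l.30–33 «any Leray–Hopf solution on T³ coincides
with u»; Thm 13.1 p.34 l.65)**: every datum/force of the class has a global Leray–Hopf solution,
classical on `(0,∞) × 𝕋³`, with which every global Leray–Hopf solution from the same `(u₀, f)` coincides
(slice-wise a.e., `t > 0`). The torus-forced analogue of the tree's `ℝ³` non-uniqueness theorem is NOT
in the tree (LOCATORS §3) — nothing is inferred from it here. [claim: Tibola2025, status: under-review]
[cite: Tibola2025, Thm .1 p.39 l.30–33; Thm 13.1 p.34 l.62–66] -/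
def ClaimedUniqueness (ν : ℝ) : Prop :=
  ∀ (u₀ : T3 → E3) (f : ℝ → T3 → E3), IsDatum u₀ → IsForce f →
    ∃ u : ℝ → T3 → E3, Torus.IsGlobalLerayHopf ν f u₀ u ∧
      (∃ p : ℝ → T3 → ℝ, Torus.IsClassicalNSSolutionOn (Ioi 0) ν f u p) ∧
        ∀ w : ℝ → T3 → E3, Torus.IsGlobalLerayHopf ν f u₀ w → ∀ t : ℝ, 0 < t → w t =ᵐ[volume] u t

/-- **CLAIMED THEOREM = Appendix B «Theorem .1» p.39 l.10–33 (faces (a) ∧ (b); energy equality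
recorded)**, at the print's fixed viscosity `ν`. [claim: Tibola2025, status: under-review]
[cite: Tibola2025, Thm .1 p.39 l.10–33] -/
def ClaimedTheorem (ν : ℝ) : Prop := ClaimedRegularity ν ∧ ClaimedUniqueness ν

/-! ## The steps of the printed chain (no assertion) -/

/-- **Step 1 — Theorem 12.19 (Pressure-decay implies CKN decay), display (12.10) p.32 l.18–38**: «Fix
any Λ > 2. Assume the scale step of Theorem 10.1 holds with θ(Λ) = κw(Λ) + cloc/Λ ∈ (0, 1) … Then for
every cylinder Qr = Qr(x0, t0) with h ≪ r ≪ 1, A_h(Q_r) ≤ θ(Λ) A_h(Q_{Λr}) + C (E_h(Q_{Λr}) +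
F_h(Q_{Λr})) (12.10)» — WITH the additive dissipation/forcing term; discrete, over the kit's functionals;
the assumption «θ(Λ) ∈ (0,1)» kept as printed. TRUE-type (CKN scale step; REF (i)).
[claim: Tibola2025, status: under-review] [cite: Tibola2025, Thm 12.19 (12.10) p.32 l.18–38] -/
def Step_T1219 (K : URKit) (L : Ledger) : Prop :=
  ∀ Λ : ℝ, 2 < Λ → 0 < L.theta Λ → L.theta Λ < 1 →
    ∃ C : ℝ≥0, ∀ (u₀ : T3 → E3) (f : ℝ → T3 → E3), IsDatum u₀ → IsForce f →
      ∀ (h r : ℝ) (z : ℝ × T3), 0 < h → h < r → Admissible (Λ * r) z →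
        K.A h u₀ f r z ≤
          ENNReal.ofReal (L.theta Λ) * K.A h u₀ f (Λ * r) z +
            (C : ℝ≥0∞) * (K.E h u₀ f (Λ * r) z + K.F h u₀ f (Λ * r) z)

/-- **Step 2 — Corollary 12.21 (Strict contraction at Λ = 6) p.32 l.67–73**: «With the far/near split
(12.11) and the analytic inputs cited above, θ(6) = κw(6) + cloc/6 < 1. Here κw(6) comes from UCw
(Corollary B.2 with εiso(6) = Ciso/6); cloc is the near-field constant (Lemma 13.8)» — the bare real
inequality over the ledger («Corollary B.2», «Lemma 13.8» are not printed in the 59 pp.; Cor 12.16 p.31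
l.47–53 prints the same line CONDITIONALLY; Appendix I′ instantiates it, `table4_theta6_lt_one`).
[claim: Tibola2025, status: under-review] [cite: Tibola2025, Cor 12.21 p.32 l.67–73; Cor 12.4 (12.1)–(12.2) p.26 l.72 – p.27 l.3] -/
def Step_C1221 (L : Ledger) : Prop := L.theta 6 < 1

/-- **Step 3 (content) — Lemma 12.20 (Geometric decay along 6-adic radii), display (12.12) p.32
l.57–64**: «Let Λ = 6 and suppose θ(6) < 1. For Φ(ρ) := ‖u‖³_{L³(Bρ)} + ‖p‖^{3/2}_{L^{3/2}(Bρ)}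
(normalized as in §§9–11), Φ(r) ≤ θ(6) Φ(6r)» — for every global Leray–Hopf solution of the class
(Thm 12.1 p.24 l.86 «every Leray–Hopf solution»; Thm 10.5 «the Leray–Hopf limit») with the scheme's
pressure, at every admissible cylinder, with the §10.2 normalisation (REF (a)); `θ(6)` is ledger-level,
fixed before `u, z₀, r` (REF (b)). A PURE contraction: the additive term of (12.10) is gone.
[claim: Tibola2025, status: under-review] [cite: Tibola2025, Lemma 12.20 (12.12) p.32 l.57–64] -/
def Step_L1220 (K : URKit) (L : Ledger) (ν : ℝ) : Prop :=
  ∀ (u₀ : T3 → E3) (f : ℝ → T3 → E3) (u : ℝ → T3 → E3), IsDatum u₀ → IsForce f →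
    Torus.IsGlobalLerayHopf ν f u₀ u →
      ∀ (r : ℝ) (z : ℝ × T3), 0 < r → Admissible (6 * r) z →
        Phi u (K.press u₀ f u) r z ≤ ENNReal.ofReal (L.theta 6) * Phi u (K.press u₀ f u) (6 * r) z

/-- **Step 3 (recorded literal face) — (12.12) with Φ EXACTLY as displayed** (space balls `B_ρ(x₀)` at
each time `t > 0`, no power of ρ, `6ρ ≤ 1/2`). Not consumed by the composition (the chain's ε-regularity
consumes the cylinder functional); recorded for the referee. [claim: Tibola2025, status: under-review]
[cite: Tibola2025, Lemma 12.20 (12.12) p.32 l.57–64] -/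
def Step_L1220_ball (K : URKit) (L : Ledger) (ν : ℝ) : Prop :=
  ∀ (u₀ : T3 → E3) (f : ℝ → T3 → E3) (u : ℝ → T3 → E3), IsDatum u₀ → IsForce f →
    Torus.IsGlobalLerayHopf ν f u₀ u →
      ∀ (ρ : ℝ) (x₀ : T3) (t : ℝ), 0 < ρ → 6 * ρ ≤ 1 / 2 → 0 < t →
        PhiBall u (K.press u₀ f u) ρ x₀ t ≤
          ENNReal.ofReal (L.theta 6) * PhiBall u (K.press u₀ f u) (6 * ρ) x₀ t

/-- **Step 3′ — THE SEAM (12.10) ⇒ (12.12), p.32 l.57–63** («Let Λ = 6 and suppose θ(6) < 1 … (normalized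
as in §§9–11)»): the scale step with its additive term and the certificate `θ(6) < 1` are asserted to
give the pure contraction — typed as the implication the words assert (no display derives it; the proof
of Thm 12.1 p.26 l.7–21 keeps an error sum `Σ_{j<k} θ^j Err(R∗/Λ₀^j)` instead).
[claim: Tibola2025, status: under-review] [cite: Tibola2025, Lemma 12.20 p.32 l.57–66; Thm 12.19 (12.10) p.32 l.18–38] -/
def Step_L1220_of (K : URKit) (L : Ledger) (ν : ℝ) : Prop :=
  Step_T1219 K L → Step_C1221 L → Step_L1220 K L ν

/-- **Step 4 — the anchor radius, proof of Thm 12.1 p.26 l.1–6**: «Fix z0 = (x0, t0) with t0 > 0 and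
select an anchor radius R∗ … so that Φ(R∗; z0) ≤ M∗ < ∞; this follows from the global L²_t H¹_x bound
and the pressure ledgers used in the scale step» — every interior point of every Leray–Hopf solution of
the class carries an admissible cylinder with Φ finite (TRUE-type for the honest pressure; kit-relative
through `π`). [claim: Tibola2025, status: under-review] [cite: Tibola2025, proof of Thm 12.1 p.26 l.1–6] -/
def Step_anchor (K : URKit) (ν : ℝ) : Prop :=
  ∀ (u₀ : T3 → E3) (f : ℝ → T3 → E3) (u : ℝ → T3 → E3), IsDatum u₀ → IsForce f →
    Torus.IsGlobalLerayHopf ν f u₀ u →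
      ∀ z : ℝ × T3, 0 < z.1 → ∃ R : ℝ, Admissible R z ∧ Phi u (K.press u₀ f u) R z < ⊤

/-- **Step 5 — Theorem 10.5 (Local ε-regularity in the limit) p.20 l.131–141, with Theorem 10.4's bound
l.100–112**: «There exist universal constants ε0 > 0, c ∈ (0,1), C < ∞ … Let u be the Leray–Hopf limit.
If (1/r²) ∬_{Q_r} (|u|³ + |π|^{3/2}) ≤ ε0, then u is regular on Q_{cr} with the same bounds» — here: `u`
is essentially bounded by `C/(r ε0^{1/3})` on `Q_{cr}` (the first bound of Thm 10.4 carried to the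
limit; the gradient bound and Hölder continuity recorded). TRUE-type (CKN ε-regularity class).
[claim: Tibola2025, status: under-review] [cite: Tibola2025, Thm 10.5 p.20 l.131–141; Thm 10.4 p.20 l.100–130] -/
def Step_T105 (K : URKit) (ν : ℝ) : Prop :=
  ∃ ε₀ : ℝ, 0 < ε₀ ∧ ∃ c : ℝ, 0 < c ∧ c < 1 ∧ ∃ C : ℝ,
    ∀ (u₀ : T3 → E3) (f : ℝ → T3 → E3) (u : ℝ → T3 → E3), IsDatum u₀ → IsForce f →
      Torus.IsGlobalLerayHopf ν f u₀ u →
        ∀ (r : ℝ) (z : ℝ × T3), Admissible r z →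
          Phi u (K.press u₀ f u) r z ≤ ENNReal.ofReal ε₀ →
            ∀ᵐ q ∂(volume.restrict (cyl (c * r) z)), ‖u q.1 q.2‖ ≤ C / (r * ε₀ ^ (1 / 3 : ℝ))

/-- **Step 6 — the Vitali passage, proof of Thm 12.1 p.26 l.25–31 / Thm .1 p.39 l.40–43**: «Then u is
Hölder on Q_{R∗/(2Λ^{k0})}(z0). A Vitali covering of any compact subset of (0, ∞) × T³ by such cylinders
yields smoothness for all t > 0» — every global Leray–Hopf solution of the class that is locally bounded
around every interior point is a classical solution on `(0,∞) × 𝕋³` (as printed, for the printed force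
class). [claim: Tibola2025, status: under-review] [cite: Tibola2025, proof of Thm 12.1 p.26 l.25–31; Thm .1 p.39 l.40–43] -/
def Step_Vitali (ν : ℝ) : Prop :=
  ∀ (u₀ : T3 → E3) (f : ℝ → T3 → E3) (u : ℝ → T3 → E3), IsDatum u₀ → IsForce f →
    Torus.IsGlobalLerayHopf ν f u₀ u → LocallyBounded u →
      ∃ p : ℝ → T3 → ℝ, Torus.IsClassicalNSSolutionOn (Ioi 0) ν f u p

/-- **Step 7 — existence of the Leray–Hopf limit, Thm .1 p.39 l.26–27** («Consider the UR-structured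
approximations of Sections P1–P5 and their Leray–Hopf limit u»): every datum/force of the class has a
global Leray–Hopf solution (TRUE-type: Hopf's theorem for the class; the scheme itself is not typed).
[claim: Tibola2025, status: under-review] [cite: Tibola2025, Thm .1 p.39 l.26–27; Thm 12.28 p.34 l.1–21] -/
def Step_Hopf (ν : ℝ) : Prop :=
  ∀ (u₀ : T3 → E3) (f : ℝ → T3 → E3), IsDatum u₀ → IsForce f →
    ∃ u : ℝ → T3 → E3, Torus.IsGlobalLerayHopf ν f u₀ u

/-- **Step 8 — «Smoothness implies energy equality and uniqueness in the Leray–Hopf class», p.26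
l.31–32 / p.39 l.43–44** (as printed, for L² data and the printed force class): a global Leray–Hopf
solution that is classical on `(0,∞) × 𝕋³` is the only global Leray–Hopf solution from its `(u₀, f)`
(slice-wise a.e., `t > 0`). [claim: Tibola2025, status: under-review] [cite: Tibola2025, p.26 l.31–32; Thm .1 p.39 l.43–44] -/
def Step_Uniq (ν : ℝ) : Prop :=
  ∀ (u₀ : T3 → E3) (f : ℝ → T3 → E3) (u : ℝ → T3 → E3), IsDatum u₀ → IsForce f →
    Torus.IsGlobalLerayHopf ν f u₀ u →
      (∃ p : ℝ → T3 → ℝ, Torus.IsClassicalNSSolutionOn (Ioi 0) ν f u p) →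
        ∀ w : ℝ → T3 → E3, Torus.IsGlobalLerayHopf ν f u₀ w → ∀ t : ℝ, 0 < t → w t =ᵐ[volume] u t

/-! ## Kernel facts about the typed steps -/

/-- **(12.13) is the plain iterate of (12.12)** — PROVED: `Φ(r) ≤ θ(6)^N Φ(6^N r)` whenever the largest
cylinder is admissible (Lemma 12.20 p.32 l.65–66 «iterating on r_k := 6^k r yields (12.13)»).
[cite: Tibola2025, Lemma 12.20 (12.13) p.32 l.65–66] -/
theorem phi_iterate_of_step_L1220 {K : URKit} {L : Ledger} {ν : ℝ} (h : Step_L1220 K L ν)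
    {u₀ : T3 → E3} {f : ℝ → T3 → E3} {u : ℝ → T3 → E3} (hd : IsDatum u₀) (hf : IsForce f)
    (hu : Torus.IsGlobalLerayHopf ν f u₀ u) (z : ℝ × T3) :
    ∀ (N : ℕ) (r : ℝ), 0 < r → Admissible (6 ^ N * r) z →
      Phi u (K.press u₀ f u) r z ≤
        ENNReal.ofReal (L.theta 6) ^ N * Phi u (K.press u₀ f u) (6 ^ N * r) z := by
  intro N
  induction N with
  | zero => intro r _ _; simp
  | succ N ih =>
    intro r hr hadm
    have h6r : 0 < 6 * r := by positivity
    have hrew : (6 : ℝ) ^ (N + 1) * r = 6 ^ N * (6 * r) := by ring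
    have hadm' : Admissible (6 ^ N * (6 * r)) z := hrew ▸ hadm
    have hle6 : 6 * r ≤ 6 ^ (N + 1) * r := by
      have h1 : (6 : ℝ) ≤ 6 ^ (N + 1) := by
        calc (6 : ℝ) = 6 ^ 1 := (pow_one _).symm
          _ ≤ 6 ^ (N + 1) := pow_le_pow_right₀ (by norm_num) (by omega)
      exact mul_le_mul_of_nonneg_right h1 hr.le
    have hadm6 : Admissible (6 * r) z := hadm.mono h6r hle6
    have h1 := h u₀ f u hd hf hu r z hr hadm6
    have h2 := ih (6 * r) h6r hadm'
    calc Phi u (K.press u₀ f u) r z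
        ≤ ENNReal.ofReal (L.theta 6) * Phi u (K.press u₀ f u) (6 * r) z := h1
      _ ≤ ENNReal.ofReal (L.theta 6) *
            (ENNReal.ofReal (L.theta 6) ^ N * Phi u (K.press u₀ f u) (6 ^ N * (6 * r)) z) :=
          mul_le_mul' le_rfl h2
      _ = ENNReal.ofReal (L.theta 6) ^ (N + 1) * Phi u (K.press u₀ f u) (6 ^ (N + 1) * r) z := by
          rw [hrew, pow_succ]; ring

/-- Pure arithmetic used by the assembly (p.26 l.22–25 «Because θ(Λ0) < 1 … choose k0 so that the
right–hand side is ≤ ε0»): if `a < 1` and `b < ∞` in `ℝ≥0∞` then `aᴺ b ≤ ε` for some `N`, `ε > 0`. [folklore] -/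
private theorem exists_pow_mul_le {a b ε : ℝ≥0∞} (ha : a < 1) (hb : b < ⊤) (hε : 0 < ε) :
    ∃ N : ℕ, a ^ N * b ≤ ε := by
  have ht : Tendsto (fun N : ℕ => a ^ N * b) atTop (𝓝 (0 * b)) :=
    ENNReal.Tendsto.mul_const (ENNReal.tendsto_pow_atTop_nhds_zero_of_lt_one ha) (Or.inr hb.ne)
  rw [zero_mul] at ht
  obtain ⟨N, hN⟩ := ((tendsto_order.1 ht).2 ε hε).exists
  exact ⟨N, hN.le⟩

/-! ## Kernel composition -/

/-- **From the pure contraction, the anchor and ε-regularity to local boundedness everywhere** (proof of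
Thm 12.1 p.26 l.6–29, composed in the kernel: iterate (12.12) from the anchor radius down until
`θ(6)^N Φ(R∗) ≤ ε0`, then apply Thm 10.5). [cite: Tibola2025, proof of Thm 12.1 p.26 l.1–29] -/
theorem locallyBounded_of_steps (K : URKit) (L : Ledger) {ν : ℝ} (h1221 : Step_C1221 L)
    (h1220 : Step_L1220 K L ν) (hA : Step_anchor K ν) (h105 : Step_T105 K ν)
    {u₀ : T3 → E3} {f : ℝ → T3 → E3} {u : ℝ → T3 → E3} (hd : IsDatum u₀) (hf : IsForce f)
    (hu : Torus.IsGlobalLerayHopf ν f u₀ u) : LocallyBounded u := by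
  intro z hz
  obtain ⟨R, hRadm, hRfin⟩ := hA u₀ f u hd hf hu z hz
  obtain ⟨ε₀, hε₀, c, hc0, _hc1, C, hreg⟩ := h105
  have hθ : ENNReal.ofReal (L.theta 6) < 1 := by
    rw [← ENNReal.ofReal_one]
    exact ENNReal.ofReal_lt_ofReal_iff'.2 ⟨h1221, one_pos⟩
  obtain ⟨N, hN⟩ := exists_pow_mul_le hθ hRfin (ENNReal.ofReal_pos.2 hε₀)
  -- the small radius r = R / 6^N
  set r : ℝ := R / 6 ^ N with hr_def
  have h6N : (0 : ℝ) < 6 ^ N := by positivity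
  have hr : 0 < r := div_pos hRadm.1 h6N
  have hRr : 6 ^ N * r = R := by rw [hr_def]; field_simp
  have hadm : Admissible (6 ^ N * r) z := hRr ▸ hRadm
  have hsmall : Phi u (K.press u₀ f u) r z ≤ ENNReal.ofReal ε₀ :=
    (phi_iterate_of_step_L1220 h1220 hd hf hu z N r hr hadm).trans (by rw [hRr]; exact hN)
  have hradm : Admissible r z := hadm.mono hr (by
    rw [hRr, hr_def]
    exact div_le_self hRadm.1.le (one_le_pow₀ (by norm_num)))
  refine ⟨c * r, by positivity, C / (r * ε₀ ^ (1 / 3 : ℝ)), ?_⟩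
  exact hreg u₀ f u hd hf hu r z hradm hsmall

/-- **The printed chain composed in the kernel, every binder consumed** (Thm 12.19 ∧ Cor 12.21 ⟹[seam]
Lemma 12.20 ⟹ (12.13) ⟹[anchor, Thm 10.5] local boundedness everywhere ⟹[Vitali] classical on (0,∞)
⟹[«smoothness implies uniqueness»] Thm .1's faces (a) ∧ (b), along the Leray–Hopf solution the scheme
provides), for the print's `ν`. [cite: Tibola2025, p.1 l.41; Thm .1 p.39 l.34–44; proof of Thm 12.1 p.26 l.1–33] -/
theorem claim_of_steps (K : URKit) (L : Ledger) {ν : ℝ}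
    (h1219 : Step_T1219 K L) (h1221 : Step_C1221 L) (h1220 : Step_L1220_of K L ν)
    (hA : Step_anchor K ν) (h105 : Step_T105 K ν) (hV : Step_Vitali ν) (hH : Step_Hopf ν)
    (hU : Step_Uniq ν) : ClaimedTheorem ν := by
  have hL : Step_L1220 K L ν := h1220 h1219 h1221
  have hreg : ∀ (u₀ : T3 → E3) (f : ℝ → T3 → E3) (u : ℝ → T3 → E3), IsDatum u₀ → IsForce f →
      Torus.IsGlobalLerayHopf ν f u₀ u → ∃ p : ℝ → T3 → ℝ, Torus.IsClassicalNSSolutionOn (Ioi 0) ν f u p :=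
    fun u₀ f u hd hf hu => hV u₀ f u hd hf hu (locallyBounded_of_steps K L h1221 hL hA h105 hd hf hu)
  refine ⟨fun u₀ f hd hf => ?_, fun u₀ f hd hf => ?_⟩
  · obtain ⟨u, hu⟩ := hH u₀ f hd hf
    exact ⟨u, hu, hreg u₀ f u hd hf hu⟩
  · obtain ⟨u, hu⟩ := hH u₀ f hd hf
    exact ⟨u, hu, hreg u₀ f u hd hf hu, hU u₀ f u hd hf hu (hreg u₀ f u hd hf hu)⟩

/-! ## The Clay link (nearest (B); the claim is WIDER — all L² data, forcing) -/

/-- A smooth `ℤ³`-periodic divergence-free datum, descended to `𝕋³`, is in the printed data class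
(`L²`, weakly divergence-free). [cite: Tibola2025, Thm .1 p.39 l.12–16] [cite: FeffermanClay2006, (8) p. 2] -/
theorem isDatum_descend {u₀ : E3 → E3} (hu₀ : ContDiff ℝ ∞ u₀) (hdiv : NSWave0.IsDivFree u₀)
    (hper : IsLatticePeriodic u₀) : IsDatum (fun y => u₀ (Torus.repr y)) := by
  have hl : Torus.lift (Torus.descend u₀ hper) = u₀ := Torus.lift_descend_holds u₀ hper
  have hs : Torus.IsSmooth (Torus.descend u₀ hper) := by
    show ContDiff ℝ ∞ (Torus.lift (Torus.descend u₀ hper))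
    rw [hl]; exact hu₀
  have hd : Torus.IsDivFree (Torus.descend u₀ hper) := by
    refine (isDivFree_lift_iff_torus hs).1 ?_
    rw [hl]; exact hdiv
  have hc : Continuous (Torus.descend u₀ hper) := hs.continuous
  obtain ⟨B, hB⟩ := isCompact_univ.exists_bound_of_continuousOn hc.continuousOn
  exact ⟨MemLp.of_bound hc.aestronglyMeasurable B (ae_of_all _ fun y => hB y (mem_univ y)),
    Torus.IsDivFree.isWeaklyDivFree_holds hs hd⟩

/-- A representative of a torus point has norm at most `2` (coordinates in `[0,1)`). [folklore] -/
private theorem norm_repr_le_two (y : T3) : ‖Torus.repr y‖ ≤ 2 := by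
  have hcoord : ∀ i, ‖Torus.repr y i‖ ^ 2 ≤ 1 := fun i => by
    have h := Torus.repr_apply_mem_Ico y i
    rw [Real.norm_eq_abs, sq_abs]
    nlinarith [h.1, h.2]
  rw [EuclideanSpace.norm_eq]
  have hs : ∑ i, ‖Torus.repr y i‖ ^ 2 ≤ 4 := by
    calc ∑ i, ‖Torus.repr y i‖ ^ 2 ≤ ∑ _i : Fin 3, (1 : ℝ) := Finset.sum_le_sum fun i _ => hcoord i
      _ ≤ 4 := by norm_num
  calc √(∑ i, ‖Torus.repr y i‖ ^ 2) ≤ √4 := Real.sqrt_le_sqrt hs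
    _ = 2 := by rw [show (4 : ℝ) = 2 ^ 2 by norm_num, Real.sqrt_sq (by norm_num)]

/-- A classical solution on `(0,∞) × 𝕋³` is bounded on every compact sub-slab `[t₁, t₂] × 𝕋³`,
`0 < t₁`. [folklore] -/
private theorem exists_bound_of_classical {ν : ℝ} {f u : ℝ → T3 → E3} {p : ℝ → T3 → ℝ}
    (hcl : Torus.IsClassicalNSSolutionOn (Ioi 0) ν f u p) {t₁ t₂ : ℝ} (ht₁ : 0 < t₁) :
    ∃ C : ℝ, ∀ t ∈ Icc t₁ t₂, ∀ y : T3, ‖u t y‖ ≤ C := by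
  have hcont : ContinuousOn (Torus.stLift u) (Icc t₁ t₂ ×ˢ Metric.closedBall (0 : E3) 2) := by
    refine hcl.smooth_velocity.continuousOn.mono (prod_mono ?_ (subset_univ _))
    exact fun t ht => lt_of_lt_of_le ht₁ ht.1
  obtain ⟨C, hC⟩ := (isCompact_Icc.prod (isCompact_closedBall (0 : E3) 2)).exists_bound_of_continuousOn hcont
  refine ⟨C, fun t ht y => ?_⟩
  have hmem : (t, Torus.repr y) ∈ Icc t₁ t₂ ×ˢ Metric.closedBall (0 : E3) 2 :=
    ⟨ht, by rw [Metric.mem_closedBall, dist_zero_right]; exact norm_repr_le_two y⟩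
  have h := hC (t, Torus.repr y) hmem
  simpa [Torus.stLift, Torus.proj_repr] using h

/-- **CLAY (B) LINK (PROVED)**: the claimed theorem, instantiated on smooth periodic divergence-free
UNFORCED data (⊂ the printed L² class; `isForce_zero`, `isDatum_descend`), gives Clay (B) at the print's
viscosity, through the tree's door `clayPeriodic_regularityAt_iff_lerayHopf_boundedFromLeft`: every global
Leray–Hopf solution from the descended datum coincides a.e. (face (b)) with the classical one (face (a)),
which is bounded on compact sub-slabs of `(0,∞) × 𝕋³`. The claim is WIDER than (B) (all L² data,
forcing): no Δ axis against the claimant. [cite: FeffermanClay2006, (B) with (8) (10) (11) p. 2]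
[cite: Tibola2025, Thm .1 p.39 l.10–33] -/
theorem clayB_of_claimed {ν : ℝ} (hν : 0 < ν) (h : ClaimedTheorem ν) : clayPeriodic.RegularityAt ν := by
  refine (clayPeriodic_regularityAt_iff_lerayHopf_boundedFromLeft hν).2 ?_
  intro u₀ hu₀ hdiv hper w hw T hT
  obtain ⟨u, hu, ⟨p, hcl⟩, huniq⟩ := h.2 (fun y => u₀ (Torus.repr y)) 0 (isDatum_descend hu₀ hdiv hper)
    isForce_zero
  obtain ⟨C, hC⟩ := exists_bound_of_classical hcl (t₁ := T / 2) (t₂ := T) (by linarith)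
  refine ⟨T / 2, by linarith, C, ?_⟩
  filter_upwards [ae_restrict_mem measurableSet_Ioo] with t ht
  filter_upwards [huniq w hw t (by linarith [ht.1])] with x hx
  rw [hx]
  exact hC t ⟨ht.1.le, ht.2.le⟩ x

/-- Clay (B) (all viscosities) from the claimed theorem at one `ν > 0` (scaling `clayPeriodic_regularityAt_iff`).
[cite: FeffermanClay2006, (B) p. 2] -/
theorem clay_of_claimed {ν : ℝ} (hν : 0 < ν) (h : ClaimedTheorem ν) : clayPeriodic.Regularity :=
  (clayPeriodic_regularityAt_iff hν).1 (clayB_of_claimed hν h)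

/-- Clay (B) from the printed chain. [cite: Tibola2025, p.1 l.41; Thm .1 p.39 l.34–44] [cite: FeffermanClay2006, (B) p. 2] -/
theorem clay_of_steps (K : URKit) (L : Ledger) {ν : ℝ} (hν : 0 < ν)
    (h1219 : Step_T1219 K L) (h1221 : Step_C1221 L) (h1220 : Step_L1220_of K L ν)
    (hA : Step_anchor K ν) (h105 : Step_T105 K ν) (hV : Step_Vitali ν) (hH : Step_Hopf ν)
    (hU : Step_Uniq ν) : clayPeriodic.Regularity :=
  clay_of_claimed hν (claim_of_steps K L h1219 h1221 h1220 hA h105 hV hH hU)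

/-! ## Keeper block (ns-claims-lit-4 g9): Clay (B) from the REGULARITY face (a) ALONE

Face (b) (Leray–Hopf uniqueness for all `L²` data and the printed force class) is beyond Clay (B); it
is not needed for the link. The per-solution door of `ClayPeriodicLerayHopfBridge` (rev 2, p549030):
ONE global Leray–Hopf solution from the descended Clay datum that is classical on `(0,∞) × 𝕋³` already
gives `clayPeriodic.Solvable` — weak–strong uniqueness is applied to THAT solution against the maximal
classical solution from the smooth datum, and the velocity blow-up alternative does the rest (both tree
theorems inside the door). [cite: FeffermanClay2006, (B) with (8) (10) (11) p. 2]
[cite: Tibola2025, Thm .1 (a) p.39 l.10–29] -/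

/-- **CLAY (B) FROM FACE (a) (PROVED, no uniqueness face)**: the regularity face at the print's `ν > 0`,
instantiated at `f ≡ 0` and a smooth periodic divergence-free datum, gives Clay (B) at `ν` through the
per-solution door `clayPeriodic_solvable_of_isGlobalLerayHopf_classical`.
[cite: FeffermanClay2006, (B) p. 2] [cite: Tibola2025, Thm .1 (a) p.39 l.10–29] -/
theorem clayB_of_claimedRegularity {ν : ℝ} (hν : 0 < ν) (h : ClaimedRegularity ν) :
    clayPeriodic.RegularityAt ν := by
  intro u₀ hu₀ hdiv hper
  obtain ⟨u, hu, p, hcl⟩ := h (fun y => u₀ (Torus.repr y)) 0 (isDatum_descend hu₀ hdiv hper) isForce_zero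
  exact clayPeriodic_solvable_of_isGlobalLerayHopf_classical hν hu₀ hdiv hper hu hcl

/-- Clay (B) (all viscosities) from face (a) at one `ν > 0`. [cite: FeffermanClay2006, (B) p. 2]
[cite: Tibola2025, Thm .1 (a) p.39 l.10–29] -/
theorem clay_of_claimedRegularity {ν : ℝ} (hν : 0 < ν) (h : ClaimedRegularity ν) :
    clayPeriodic.Regularity :=
  (clayPeriodic_regularityAt_iff hν).1 (clayB_of_claimedRegularity hν h)

/-- The composition of record re-routed through face (a): the link needs neither `Step_Uniq` nor face (b).
[cite: FeffermanClay2006, (B) p. 2] [cite: Tibola2025, Thm .1 p.39 l.34–44] -/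
theorem clay_of_steps_regularity (K : URKit) (L : Ledger) {ν : ℝ} (hν : 0 < ν)
    (h1219 : Step_T1219 K L) (h1221 : Step_C1221 L) (h1220 : Step_L1220_of K L ν)
    (hA : Step_anchor K ν) (h105 : Step_T105 K ν) (hV : Step_Vitali ν) (hH : Step_Hopf ν) :
    clayPeriodic.Regularity := by
  refine clay_of_claimedRegularity hν fun u₀ f hd hf => ?_
  obtain ⟨u, hu⟩ := hH u₀ f hd hf
  exact ⟨u, hu, hV u₀ f u hd hf hu
    (locallyBounded_of_steps K L h1221 (h1220 h1219 h1221) hA h105 hd hf hu)⟩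

end

end Literature.Claims.NS.Tibola2025
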